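import Summits.PneNP.PneNP.Theorems.SymmetryBudgetWindowCanoniserActLemmas

/-!
# Window canoniser, IX (continued): how relabelling acts on the atom builders

Route `PneNP/SymmetryBudget`, dichotomy `WindowBarrier` (stmt-PneNP-2145) / `NoHiddenOrder` (stmt-PneNP-14781);
continuation of `…WindowCanoniserActLemmas.lean`: `simp` lemmas `(aX L …).act π = aX (L.act π) …` for every atom
builder (label and vertex parameters renamed, everything else fixed).
-/

-- `Summit.PneNP.PneNP.…` duplicates `PneNP` BY DESIGN (single-problem summit, D-0017 layout).
set_option linter.dupNamespace false

noncomputable section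

namespace Summit.PneNP.PneNP.Theorems

namespace WCan

open Finset Equiv Literature.Computability.Complexity

variable {K r n : ℕ} (π : Perm (Fin n))

/-! ### Atom builders -/

section AtomBuilders

variable [NeZero n] (L : Lab K n)

/-- `act_aExV`: bookkeeping/simp lemma (act aExV). -/
@[simp] theorem act_aExV (u : Fin n) (v : Fin n) :
    (aExV (K := K) (r := r) u v).act π = aExV (π u) (π v) := by
  simp [aExV]

/-- `act_aExO`: bookkeeping/simp lemma (act aExO). -/
@[simp] theorem act_aExO (v : Fin n) (o : Fin r) :
    (aExO (K := K) v o).act π = aExO (π v) o := by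
  simp [aExO]

/-- `act_aRLT`: bookkeeping/simp lemma (act aRLT). -/
@[simp] theorem act_aRLT (rd : Fin (n + 1)) (u : Fin n) (w : Fin n) :
    (aRLT (K := K) (r := r) rd u w).act π = aRLT rd (π u) (π w) := by
  simp [aRLT]

/-- `act_aRcge`: bookkeeping/simp lemma (act aRcge). -/
@[simp] theorem act_aRcge (rd : Fin (n + 1)) (u : Fin n) (v : Fin n) (w : Fin n) :
    (aRcge (K := K) (r := r) rd u v w).act π = aRcge rd (π u) (π v) (π w) := by
  simp [aRcge]

/-- `act_aRallb`: bookkeeping/simp lemma (act aRallb). -/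
@[simp] theorem act_aRallb (rd : Fin (n + 1)) (u : Fin n) (v : Fin n) (w : Fin n) :
    (aRallb (K := K) (r := r) rd u v w).act π = aRallb rd (π u) (π v) (π w) := by
  simp [aRallb]

/-- `act_aRlex`: bookkeeping/simp lemma (act aRlex). -/
@[simp] theorem act_aRlex (rd : Fin (n + 1)) (u : Fin n) (v : Fin n) :
    (aRlex (K := K) (r := r) rd u v).act π = aRlex rd (π u) (π v) := by
  simp [aRlex]

/-- `act_aW`: bookkeeping/simp lemma (act aW). -/
@[simp] theorem act_aW (it : Fin (T n + 1)) (v : Fin n) :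
    (aW (r := r) L it v).act π = aW (L.act π) it (π v) := by
  simp [aW]

/-- `act_aLT`: bookkeeping/simp lemma (act aLT). -/
@[simp] theorem act_aLT (it : Fin (T n + 1)) (u : Fin n) (w : Fin n) :
    (aLT (r := r) L it u w).act π = aLT (L.act π) it (π u) (π w) := by
  simp [aLT]

/-- `act_aC`: bookkeeping/simp lemma (act aC). -/
@[simp] theorem act_aC (it : Fin (T n + 1)) (v : Fin n) :
    (aC (r := r) L it v).act π = aC (L.act π) it (π v) := by
  simp [aC]

/-- `act_aARR`: bookkeeping/simp lemma (act aARR). -/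
@[simp] theorem act_aARR (it : Fin (T n + 1)) (z : Fin n) :
    (aARR (r := r) L it z).act π = aARR (L.act π) it (π z) := by
  simp [aARR]

/-- `act_aDEAD`: bookkeeping/simp lemma (act aDEAD). -/
@[simp] theorem act_aDEAD (it : Fin (T n + 1)) (z : Fin n) :
    (aDEAD (r := r) L it z).act π = aDEAD (L.act π) it (π z) := by
  simp [aDEAD]

/-- `act_aFrz`: bookkeeping/simp lemma (act aFrz). -/
@[simp] theorem act_aFrz (it : Fin (T n + 1)) (z : Fin n) :
    (aFrz (r := r) L it z).act π = aFrz (L.act π) it (π z) := by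
  simp [aFrz]

/-- `act_aNow`: bookkeeping/simp lemma (act aNow). -/
@[simp] theorem act_aNow (it : Fin (T n + 1)) (z : Fin n) :
    (aNow (r := r) L it z).act π = aNow (L.act π) it (π z) := by
  simp [aNow]

/-- `act_aCnt1`: bookkeeping/simp lemma (act aCnt1). -/
@[simp] theorem act_aCnt1 (it : Fin (T n + 1)) (z : Fin n) :
    (aCnt1 (r := r) L it z).act π = aCnt1 (L.act π) it (π z) := by
  simp [aCnt1]

/-- `act_aConn`: bookkeeping/simp lemma (act aConn). -/
@[simp] theorem act_aConn (it : Fin (T n + 1)) (z : Fin n) :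
    (aConn (r := r) L it z).act π = aConn (L.act π) it (π z) := by
  simp [aConn]

/-- `act_aHasSel`: bookkeeping/simp lemma (act aHasSel). -/
@[simp] theorem act_aHasSel (it : Fin (T n + 1)) (z : Fin n) :
    (aHasSel (r := r) L it z).act π = aHasSel (L.act π) it (π z) := by
  simp [aHasSel]

/-- `act_aPok`: bookkeeping/simp lemma (act aPok). -/
@[simp] theorem act_aPok (it : Fin (T n + 1)) (z : Fin n) :
    (aPok (r := r) L it z).act π = aPok (L.act π) it (π z) := by
  simp [aPok]

/-- `act_aSw`: bookkeeping/simp lemma (act aSw). -/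
@[simp] theorem act_aSw (it : Fin (T n + 1)) (v : Fin n) (w : Fin n) :
    (aSw (r := r) L it v w).act π = aSw (L.act π) it (π v) (π w) := by
  simp [aSw]

/-- `act_aReach`: bookkeeping/simp lemma (act aReach). -/
@[simp] theorem act_aReach (it : Fin (T n + 1)) (s : Fin (n + 1)) (u : Fin n) (y : Fin n) :
    (aReach (r := r) L it s u y).act π = aReach (L.act π) it s (π u) (π y) := by
  simp [aReach]

/-- `act_aSzGE`: bookkeeping/simp lemma (act aSzGE). -/
@[simp] theorem act_aSzGE (it : Fin (T n + 1)) (v : Fin n) (w : Fin n) :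
    (aSzGE (r := r) L it v w).act π = aSzGE (L.act π) it (π v) (π w) := by
  simp [aSzGE]

/-- `act_aBig`: bookkeeping/simp lemma (act aBig). -/
@[simp] theorem act_aBig (it : Fin (T n + 1)) (v : Fin n) :
    (aBig (r := r) L it v).act π = aBig (L.act π) it (π v) := by
  simp [aBig]

/-- `act_aBmc`: bookkeeping/simp lemma (act aBmc). -/
@[simp] theorem act_aBmc (it : Fin (T n + 1)) (v : Fin n) :
    (aBmc (r := r) L it v).act π = aBmc (L.act π) it (π v) := by
  simp [aBmc]

/-- `act_aSel`: bookkeeping/simp lemma (act aSel). -/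
@[simp] theorem act_aSel (it : Fin (T n + 1)) (v : Fin n) :
    (aSel (r := r) L it v).act π = aSel (L.act π) it (π v) := by
  simp [aSel]

/-- `act_aNWs`: bookkeeping/simp lemma (act aNWs). -/
@[simp] theorem act_aNWs (it : Fin (T n + 1)) (v : Fin n) :
    (aNWs (r := r) L it v).act π = aNWs (L.act π) it (π v) := by
  simp [aNWs]

/-- `act_aFLT`: bookkeeping/simp lemma (act aFLT). -/
@[simp] theorem act_aFLT (it : Fin (T n + 1)) (rd : Fin (n + 1)) (u : Fin n) (w : Fin n) :
    (aFLT (r := r) L it rd u w).act π = aFLT (L.act π) it rd (π u) (π w) := by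
  simp [aFLT]

/-- `act_aFcge`: bookkeeping/simp lemma (act aFcge). -/
@[simp] theorem act_aFcge (it : Fin (T n + 1)) (rd : Fin (n + 1)) (u : Fin n) (v : Fin n) (w : Fin n) :
    (aFcge (r := r) L it rd u v w).act π = aFcge (L.act π) it rd (π u) (π v) (π w) := by
  simp [aFcge]

/-- `act_aFallb`: bookkeeping/simp lemma (act aFallb). -/
@[simp] theorem act_aFallb (it : Fin (T n + 1)) (rd : Fin (n + 1)) (u : Fin n) (v : Fin n) (w : Fin n) :
    (aFallb (r := r) L it rd u v w).act π = aFallb (L.act π) it rd (π u) (π v) (π w) := by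
  simp [aFallb]

/-- `act_aFlex`: bookkeeping/simp lemma (act aFlex). -/
@[simp] theorem act_aFlex (it : Fin (T n + 1)) (rd : Fin (n + 1)) (u : Fin n) (v : Fin n) :
    (aFlex (r := r) L it rd u v).act π = aFlex (L.act π) it rd (π u) (π v) := by
  simp [aFlex]

/-- `act_aRkGE`: bookkeeping/simp lemma (act aRkGE). -/
@[simp] theorem act_aRkGE (w : Fin n) (j : Fin (n + 1)) :
    (aRkGE (r := r) L w j).act π = aRkGE (L.act π) (π w) j := by
  simp [aRkGE]

/-- `act_aIvbit`: bookkeeping/simp lemma (act aIvbit). -/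
@[simp] theorem act_aIvbit (z : Fin n) (b : Fin (NB r n)) :
    (aIvbit L z b).act π = aIvbit (L.act π) (π z) b := by
  simp [aIvbit]

/-- `act_aInonbot`: bookkeeping/simp lemma (act aInonbot). -/
@[simp] theorem act_aInonbot (z : Fin n) :
    (aInonbot (r := r) L z).act π = aInonbot (L.act π) (π z) := by
  simp [aInonbot]

/-- `act_aIsP`: bookkeeping/simp lemma (act aIsP). -/
@[simp] theorem act_aIsP (u : Fin n) (U' : Finset (Fin n)) :
    (aIsP (r := r) L u U').act π = aIsP (L.act π) (π u) (U'.map π.toEmbedding) := by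
  simp [aIsP]

/-- `act_aPcov`: bookkeeping/simp lemma (act aPcov). -/
@[simp] theorem act_aPcov (u : Fin n) :
    (aPcov (r := r) L u).act π = aPcov (L.act π) (π u) := by
  simp [aPcov]

/-- `act_aPnonbot`: bookkeeping/simp lemma (act aPnonbot). -/
@[simp] theorem act_aPnonbot (z : Fin n) :
    (aPnonbot (r := r) L z).act π = aPnonbot (L.act π) (π z) := by
  simp [aPnonbot]

/-- `act_aPbit`: bookkeeping/simp lemma (act aPbit). -/
@[simp] theorem act_aPbit (u : Fin n) (i : Fin (NBp r n)) :
    (aPbit L u i).act π = aPbit (L.act π) (π u) i := by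
  simp [aPbit]

/-- `act_aRkInGE`: bookkeeping/simp lemma (act aRkInGE). -/
@[simp] theorem act_aRkInGE (U' : Finset (Fin n)) (w : Fin n) (j : Fin (n + 1)) :
    (aRkInGE (r := r) L U' w j).act π = aRkInGE (L.act π) (U'.map π.toEmbedding) (π w) j := by
  simp [aRkInGE]

/-- `act_aPcP`: bookkeeping/simp lemma (act aPcP). -/
@[simp] theorem act_aPcP (U' : Finset (Fin n)) (p : Fin n) (w : Fin n) :
    (aPcP (r := r) L U' p w).act π = aPcP (L.act π) (U'.map π.toEmbedding) p (π w) := by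
  simp [aPcP]

/-- `act_aPpc`: bookkeeping/simp lemma (act aPpc). -/
@[simp] theorem act_aPpc (u : Fin n) (p : Fin n) (w : Fin n) :
    (aPpc (r := r) L u p w).act π = aPpc (L.act π) (π u) p (π w) := by
  simp [aPpc]

/-- `act_aPcrk`: bookkeeping/simp lemma (act aPcrk). -/
@[simp] theorem act_aPcrk (u : Fin n) (p : Fin n) (j : Fin n) :
    (aPcrk (r := r) L u p j).act π = aPcrk (L.act π) (π u) p j := by
  simp [aPcrk]

/-- `act_aPpfx`: bookkeeping/simp lemma (act aPpfx). -/
@[simp] theorem act_aPpfx (u : Fin n) (u' : Fin n) (t : Fin (NBp r n + 1)) :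
    (aPpfx L u u' t).act π = aPpfx (L.act π) (π u) (π u') t := by
  simp [aPpfx]

/-- `act_aPlexLT`: bookkeeping/simp lemma (act aPlexLT). -/
@[simp] theorem act_aPlexLT (u : Fin n) (u' : Fin n) :
    (aPlexLT (r := r) L u u').act π = aPlexLT (L.act π) (π u) (π u') := by
  simp [aPlexLT]

/-- `act_aPlexEQ`: bookkeeping/simp lemma (act aPlexEQ). -/
@[simp] theorem act_aPlexEQ (u : Fin n) (u' : Fin n) :
    (aPlexEQ (r := r) L u u').act π = aPlexEQ (L.act π) (π u) (π u') := by
  simp [aPlexEQ]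

/-- `act_aPstGE`: bookkeeping/simp lemma (act aPstGE). -/
@[simp] theorem act_aPstGE (u : Fin n) (t : Fin (n + 1)) :
    (aPstGE (r := r) L u t).act π = aPstGE (L.act π) (π u) t := by
  simp [aPstGE]

/-- `act_aPbcGE`: bookkeeping/simp lemma (act aPbcGE). -/
@[simp] theorem act_aPbcGE (u : Fin n) (t : Fin (n + 1)) :
    (aPbcGE (r := r) L u t).act π = aPbcGE (L.act π) (π u) t := by
  simp [aPbcGE]

/-- `act_aPat`: bookkeeping/simp lemma (act aPat). -/
@[simp] theorem act_aPat (p : Fin n) (u : Fin n) (i : Fin n) (o : Fin n) :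
    (aPat (r := r) L p u i o).act π = aPat (L.act π) p (π u) i o := by
  simp [aPat]

/-- `act_aOff`: bookkeeping/simp lemma (act aOff). -/
@[simp] theorem act_aOff (p : Fin n) (u : Fin n) (o : Fin n) :
    (aOff (r := r) L p u o).act π = aOff (L.act π) p (π u) o := by
  simp [aOff]

/-- `act_aBlkI`: bookkeeping/simp lemma (act aBlkI). -/
@[simp] theorem act_aBlkI (p : Fin n) (u : Fin n) (i : Fin n) :
    (aBlkI (r := r) L p u i).act π = aBlkI (L.act π) p (π u) i := by
  simp [aBlkI]

/-- `act_aSamePart`: bookkeeping/simp lemma (act aSamePart). -/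
@[simp] theorem act_aSamePart (p : Fin n) (q : Fin n) (z : Fin n) :
    (aSamePart (r := r) L p q z).act π = aSamePart (L.act π) p q (π z) := by
  simp [aSamePart]

/-- `act_aSpc`: bookkeeping/simp lemma (act aSpc). -/
@[simp] theorem act_aSpc (p : Fin n) (w : Fin n) :
    (aSpc (r := r) L p w).act π = aSpc (L.act π) p (π w) := by
  simp [aSpc]

/-- `act_aSvadj`: bookkeeping/simp lemma (act aSvadj). -/
@[simp] theorem act_aSvadj (p : Fin n) (q : Fin n) (z : Fin n) :
    (aSvadj (r := r) L p q z).act π = aSvadj (L.act π) p q (π z) := by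
  simp [aSvadj]

/-- `act_aSvext`: bookkeeping/simp lemma (act aSvext). -/
@[simp] theorem act_aSvext (p : Fin n) (o : Fin r) (z : Fin n) :
    (aSvext L p o z).act π = aSvext (L.act π) p o (π z) := by
  simp [aSvext]

/-- `act_aSvcrk`: bookkeeping/simp lemma (act aSvcrk). -/
@[simp] theorem act_aSvcrk (p : Fin n) (j : Fin n) (z : Fin n) :
    (aSvcrk (r := r) L p j z).act π = aSvcrk (L.act π) p j (π z) := by
  simp [aSvcrk]

/-- `act_aVbit`: bookkeeping/simp lemma (act aVbit). -/
@[simp] theorem act_aVbit (z : Fin n) (b : Fin (NB r n)) :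
    (aVbit L z b).act π = aVbit (L.act π) (π z) b := by
  simp [aVbit]

/-- `act_aPcand`: bookkeeping/simp lemma (act aPcand). -/
@[simp] theorem act_aPcand (κ : Fin n × Fin (n + 1)) (p w : Fin n) :
    (aPcand (r := r) L κ p w).act π = aPcand (L.act π) (π κ.1, κ.2) p (π w) := by
  simp [aPcand]

/-- `act_aLcrk`: bookkeeping/simp lemma (act aLcrk). -/
@[simp] theorem act_aLcrk (κ : Fin n × Fin (n + 1)) (p j : Fin n) :
    (aLcrk (r := r) L κ p j).act π = aLcrk (L.act π) (π κ.1, κ.2) p j := by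
  simp [aLcrk]

/-- `act_aPfx`: bookkeeping/simp lemma (act aPfx). -/
@[simp] theorem act_aPfx (κ κ' : Fin n × Fin (n + 1)) (t : Fin (NB r n + 1)) :
    (aPfx L κ κ' t).act π = aPfx (L.act π) (π κ.1, κ.2) (π κ'.1, κ'.2) t := by
  simp [aPfx]

/-- `act_aLexLE`: bookkeeping/simp lemma (act aLexLE). -/
@[simp] theorem act_aLexLE (κ κ' : Fin n × Fin (n + 1)) :
    (aLexLE (r := r) L κ κ').act π = aLexLE (L.act π) (π κ.1, κ.2) (π κ'.1, κ'.2) := by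
  simp [aLexLE]

/-- `act_aBest`: bookkeeping/simp lemma (act aBest). -/
@[simp] theorem act_aBest (κ : Fin n × Fin (n + 1)) :
    (aBest (r := r) L κ).act π = aBest (L.act π) (π κ.1, κ.2) := by
  simp [aBest]

/-- The action on a candidate child index. -/
abbrev chAct (ch : Ch n) : Ch n := Sum.map (fun κ => (π κ.1, κ.2)) (fun U' => U'.map π.toEmbedding) ch

/-- `prmCh_act`: bookkeeping/simp lemma (prmCh act). -/
@[simp] theorem prmCh_act (ch : Ch n) (z : Fin n) (it : Fin (T n + 1)) :
    (prmCh ch z it : Prm r n).act π = prmCh (chAct π ch) (π z) it := by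
  rcases ch with ⟨x, h⟩ | U' <;> simp [prmCh]

/-- `act_aMtch`: bookkeeping/simp lemma (act aMtch). -/
@[simp] theorem act_aMtch (ch : Ch n) (z : Fin n) (it : Fin (T n + 1)) :
    (aMtch (r := r) L ch z it).act π = aMtch (L.act π) (chAct π ch) (π z) it := by
  simp [aMtch]

/-- `act_aThru`: bookkeeping/simp lemma (act aThru). -/
@[simp] theorem act_aThru (ch : Ch n) (z : Fin n) : (aThru (r := r) L ch z).act π = aThru (L.act π) (chAct π ch) (π z) := by
  simp [aThru]

/-- `act_aCert`: bookkeeping/simp lemma (act aCert). -/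
@[simp] theorem act_aCert (ch : Ch n) (z : Fin n) : (aCert (r := r) L ch z).act π = aCert (L.act π) (chAct π ch) (π z) := by
  simp [aCert]

end AtomBuilders

end WCan

end Summit.PneNP.PneNP.Theorems

end
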